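import Mathlib
import Summits.Ventures.PercRepro2.SwOutAll
import Summits.Ventures.PercRepro2.SwOutCyclicDefs
import Summits.Ventures.PercRepro2.SwOutJunctionSplit
import Summits.Ventures.PercRepro2.SwOutJunctionIndDefs
import Summits.Ventures.PercRepro2.SwOutJunctionInd

/-!
# An instance of the junction-region theorem (blind cell PercRepro2, night-4 g11, 2026-08-25;
proofs/NIGHT4-G11.md §3)

Row (SW) on a graph that is neither cyclic (g10) nor a base junction region: `K₄` on `{h, u, o, b}`
with the path `h − a − u` and the apex `l` joined to `o` and `b` (`sw_theta_plus`): the path vertex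
`a` is series-reduced and the junction `u` (four edges, none to `l`) is the base.
-/

namespace Summit.Ventures.PercRepro2

namespace LocRows

open Hull

open scoped Classical

/-! ## Instance: `K₄` on `{h, u, o, b}` with the path `h − a − u` and the apex `l` joined to `o, b` -/

/-- The graph on `Fin 6`: `l = 0`, `h = 1`, `u = 2`, `o = 3`, the path vertex `a = 4`, `b = 5`;
`K₄` on `{1, 2, 3, 5}`, the path `1 − 4 − 2`, and `0` joined to `3` and `5`.  The junction `u = 2`
has four edges, none to `l`; `a = 4` is a path vertex without outside edge. -/
def thetaPlus : Fin 9 → Sym2 (Fin 6)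
  | 0 => s(0, 3) | 1 => s(0, 5) | 2 => s(1, 2) | 3 => s(1, 3) | 4 => s(1, 4) | 5 => s(1, 5)
  | 6 => s(2, 3) | 7 => s(2, 4) | 8 => s(2, 5)

/-- **Row (SW) on `thetaPlus`** with `l = 0`, `h = 1`, `o = 3`: neither cyclic (the junction
`2` has four edges among the non-`l` vertices) nor a base junction region (`4` has no outside
edge) — the series reduction at `4` and the junction theorem together. -/
theorem sw_theta_plus : Sw thetaPlus 0 1 3 := by
  refine sw_of_junctionRegion (l := 0) (h := 1) (o := 3) (u := 2) (by decide) (by decide)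
    (by decide) thetaPlus ?_ ?_
  · intro x hx hx1 hx3 hx2
    fin_cases x
    · simp at hx
    · exact absurd rfl hx1
    · exact absurd rfl hx2
    · exact absurd rfl hx3
    · -- the path vertex `4`
      right
      refine ⟨?_, ?_⟩
      · intro e he y hy
        fin_cases e <;> simp [thetaPlus] at he hy ⊢ <;> omega
      · have h47 : edgesAt thetaPlus 4 = {4, 7} := by
          ext e
          rw [mem_edgesAt, Finset.mem_insert, Finset.mem_singleton]
          fin_cases e <;> simp [thetaPlus]
        show (edgesAt thetaPlus 4).card ≤ 2
        rw [h47]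
        decide
    · exact Or.inl ⟨1, 0, by rw [Sym2.eq_swap]; rfl, by simp⟩
  · intro e p hep hph
    fin_cases e <;> simp only [thetaPlus] at hep <;> rw [Sym2.eq_iff] at hep <;>
      rcases hep with ⟨h1, h2⟩ | ⟨h1, h2⟩
    · exact absurd h1 (by decide)
    · exact absurd h2 (by decide)
    · exact absurd h1 (by decide)
    · exact absurd h2 (by decide)
    · exact absurd h1 (by decide)
    · exact absurd hph (by rw [← h1]; decide)
    · exact absurd h1 (by decide)
    · exact absurd h2 (by decide)
    · exact absurd h1 (by decide)
    · exact absurd h2 (by decide)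
    · exact absurd h1 (by decide)
    · exact absurd h2 (by decide)
    · exact ⟨3, by rw [← h2, Sym2.eq_swap]; rfl⟩
    · exact absurd h2 (by decide)
    · exact ⟨4, by rw [← h2, Sym2.eq_swap]; rfl⟩
    · exact absurd h2 (by decide)
    · exact ⟨5, by rw [← h2, Sym2.eq_swap]; rfl⟩
    · exact absurd h2 (by decide)

end LocRows

end Summit.Ventures.PercRepro2
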